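import Literature.AlgebraicGeometry.Motives.HodgeLieDerivedSemisimple
import Literature.AlgebraicGeometry.Motives.MumfordTateLieAlgebraEqHodgeLie
import HarnessLib

/-!
# The Mumford–Tate Lie algebra of an effective polarizable weight-one Hodge structure has CENTRAL RADICAL over `ℚ` («`MT(V, h)` is reductive», Deligne LNM 900 I Prop. 3.6, Lie form in Mathlib's spelling)

Family `hodge`, layer `Literature/AlgebraicGeometry/Motives` (abstract polarizable `ℚ`-Hodge structures; no geometry). Cell
`pub-hodgecm2` (COR-CM), seat `b27` (count-neutral own lane MT-REDUCTIVE); UNCONDITIONAL, theorems only (no definition, no named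
fact, D-0026); no step towards a summit statement. Sequel of `HodgeLieDerivedSemisimple` (`𝔡 = [𝔥, 𝔥]` has trivial radical,
`𝔥 = hodgeLie H`), `HodgeLieCentralRadical` (the case `𝔤 = 𝔥`) and `MumfordTateLieAlgebraEqHodgeLie` (`𝔪𝔱 = 𝔥 ⊕ ℚ·id`).

PRINTED RESULT. P. Deligne, *Hodge cycles on abelian varieties*, LNM 900 (1982), I Prop. 3.6 (held, re-ed. p. 25): «Soit
`(V, h)` une structure de Hodge rationnelle polarisable. Alors `MT(V, h)` est réductif.» Mathlib: `LieAlgebra.HasCentralRadical`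
(«Such Lie algebras are called *reductive*, if the coefficients are a field of characteristic zero»).

THIS FILE (effective polarized `H` of weight `1` on a finite-dimensional `V`; Lie subalgebras of `𝔤𝔩(V)` for the commutator
bracket `LieRing.ofAssociativeRing`, supplied by a `letI` in each statement; `𝔡 = span_ℚ {XY - YX : X, Y ∈ 𝔥}`):
* `hasCentralRadical_of_derived_le` — EVERY Lie subalgebra `𝔏 ≤ 𝔤𝔩(V)` with `𝔡 ⊆ 𝔏` and `[𝔏, 𝔏] ⊆ 𝔡` has `rad 𝔏 = Z(𝔏)`
  (the elements of `rad 𝔏` inside `𝔡` form a solvable ideal of the semisimple `𝔡`, hence vanish; so `[𝔏, rad 𝔏] = 0`);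
* `commutator_mem_hodgeLie_derived_of_mem_mumfordTateLieAlgebra` — `[𝔪𝔱, 𝔪𝔱] ⊆ 𝔡` (`𝔪𝔱 = 𝔥 ⊕ ℚ·id`), and
  `hodgeLie_derived_le_mumfordTateLieAlgebra` (`𝔡 ⊆ 𝔥 ⊆ 𝔪𝔱`);
* **`hasCentralRadical_of_eq_mumfordTateLieAlgebra`** — for every Lie subalgebra with carrier `𝔪𝔱 = mumfordTateLieAlgebra H`:
  `LieAlgebra.HasCentralRadical ℚ 𝔏` — DELIGNE I 3.6 in Lie form;
* `mumfordTateLieAlgebra_derived_eq` — `[𝔪𝔱, 𝔪𝔱] = [𝔥, 𝔥]` as spans (so the semisimple part of `𝔪𝔱` is that of `𝔥`).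
-/

noncomputable section

open scoped TensorProduct

namespace Literature.AlgebraicGeometry.Motives

namespace HodgeStructure

universe u

variable {V : Type u} [AddCommGroup V] [Module ℚ V] [Module.Finite ℚ V] [HodgeTensorFacts.{u, u}] {n : ℤ}

/-- **Every Lie subalgebra `𝔏 ≤ 𝔤𝔩(V)` with `[𝔥, 𝔥] ⊆ 𝔏` and `[𝔏, 𝔏] ⊆ [𝔥, 𝔥]` has central radical** (`H` effective,
polarized, weight one; e.g. `𝔏 = 𝔥`, `𝔏 = 𝔪𝔱`, or `[𝔥,𝔥] ⊕ 𝔞` for any commutative `𝔞` commuting with `[𝔥,𝔥]`): for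
`r ∈ rad 𝔏`, `x ∈ 𝔏`, `[x, r]` lies in `rad 𝔏 ∩ [𝔥,𝔥]`, a solvable ideal of the semisimple `[𝔥, 𝔥]`
(`hasTrivialRadical_of_eq_hodgeLie_derived`), hence `[x, r] = 0`. [cite: Deligne1982HodgeCycles, I §3 Prop. 3.6]
[cite: MoonenZarhin1999LowDim, §1] -/
theorem hasCentralRadical_of_derived_le (H : HodgeStructure V n) (hn : n = 1) (heff : H.IsEffective) (ψ : H.Polarization) :
    letI : LieRing (Module.End ℚ V) := LieRing.ofAssociativeRing
    ∀ (𝔏 : LieSubalgebra ℚ (Module.End ℚ V)),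
      Submodule.span ℚ {B | ∃ X ∈ H.hodgeLie, ∃ Y ∈ H.hodgeLie, X * Y - Y * X = B} ≤ 𝔏.toSubmodule →
      (∀ X ∈ 𝔏, ∀ Y ∈ 𝔏, X * Y - Y * X ∈ Submodule.span ℚ {B | ∃ X ∈ H.hodgeLie, ∃ Y ∈ H.hodgeLie, X * Y - Y * X = B}) →
      LieAlgebra.HasCentralRadical ℚ 𝔏 := by
  letI : LieRing (Module.End ℚ V) := LieRing.ofAssociativeRing
  intro 𝔏 h𝔡𝔏 hbr𝔏
  classical
  have hmem : ∀ X : Module.End ℚ V,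
      X ∈ Submodule.span ℚ {B | ∃ X ∈ H.hodgeLie, ∃ Y ∈ H.hodgeLie, X * Y - Y * X = B} → X ∈ 𝔏 := fun X hX => by
    rw [← LieSubalgebra.mem_toSubmodule]; exact h𝔡𝔏 hX
  -- the derived algebra as a Lie subalgebra `𝔏d`, with trivial radical
  obtain ⟨𝔏d, h𝔏d⟩ := exists_lieSubalgebra_eq_hodgeLie_derived H
  haveI hrad : LieAlgebra.HasTrivialRadical ℚ 𝔏d := hasTrivialRadical_of_eq_hodgeLie_derived H hn heff ψ 𝔏d h𝔏d
  have hmemd : ∀ X : Module.End ℚ V, X ∈ 𝔏d ↔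
      X ∈ Submodule.span ℚ {B | ∃ X ∈ H.hodgeLie, ∃ Y ∈ H.hodgeLie, X * Y - Y * X = B} := fun X => by
    rw [← LieSubalgebra.mem_toSubmodule, h𝔏d]
  set R : LieIdeal ℚ 𝔏 := LieAlgebra.radical ℚ 𝔏 with hR
  -- the elements of `R` lying in `𝔡`, as a Lie ideal of `𝔏d`
  let R' : LieIdeal ℚ 𝔏d :=
    { carrier := {d | ∃ r : 𝔏, r ∈ R ∧ (r : Module.End ℚ V) = d}
      add_mem' := by
        rintro d d' ⟨r, hr, hrd⟩ ⟨r', hr', hrd'⟩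
        refine ⟨r + r', R.add_mem hr hr', ?_⟩
        change (r : Module.End ℚ V) + r' = (d : Module.End ℚ V) + d'
        rw [hrd, hrd']
      zero_mem' := ⟨0, R.zero_mem, rfl⟩
      smul_mem' := by
        rintro c d ⟨r, hr, hrd⟩
        refine ⟨c • r, R.smul_mem c hr, ?_⟩
        change c • (r : Module.End ℚ V) = c • (d : Module.End ℚ V)
        rw [hrd]
      lie_mem := by
        rintro x d ⟨r, hr, hrd⟩
        have hx𝔏 : ((x : 𝔏d) : Module.End ℚ V) ∈ 𝔏 := hmem _ ((hmemd _).1 x.2)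
        refine ⟨⁅(⟨(x : Module.End ℚ V), hx𝔏⟩ : 𝔏), r⁆, R.lie_mem hr, ?_⟩
        rw [LieSubalgebra.coe_bracket, LieRing.of_associative_ring_bracket, hrd, LieSubalgebra.coe_bracket,
          LieRing.of_associative_ring_bracket] }
  have hR'mem : ∀ d : 𝔏d, d ∈ R' ↔ ∃ r : 𝔏, r ∈ R ∧ (r : Module.End ℚ V) = d := fun d => Iff.rfl
  -- `R'` embeds into `R`, hence is solvable
  choose ρ hρR hρval using fun d : R' => (hR'mem _).1 d.2
  have hcoe : ∀ d d' : R', ((⁅d, d'⁆ : R') : 𝔏d) = ⁅(d : 𝔏d), (d' : 𝔏d)⁆ := fun d d' => rfl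
  have hcoeR : ∀ a b : R, ((⁅a, b⁆ : R) : 𝔏) = ⁅(a : 𝔏), (b : 𝔏)⁆ := fun a b => rfl
  let φ : R' →ₗ⁅ℚ⁆ R :=
    { toFun := fun d => ⟨ρ d, hρR d⟩
      map_add' := fun d d' => by
        apply Subtype.ext; apply Subtype.ext
        change (ρ (d + d') : Module.End ℚ V) = (ρ d : Module.End ℚ V) + ρ d'
        rw [hρval, hρval, hρval]
        rfl
      map_smul' := fun c d => by
        apply Subtype.ext; apply Subtype.ext
        change (ρ (c • d) : Module.End ℚ V) = c • (ρ d : Module.End ℚ V)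
        rw [hρval, hρval]
        rfl
      map_lie' := fun {d d'} => by
        apply Subtype.ext; apply Subtype.ext
        change (ρ ⁅d, d'⁆ : Module.End ℚ V) = (((⁅(⟨ρ d, hρR d⟩ : R), ⟨ρ d', hρR d'⟩⁆ : R) : 𝔏) : Module.End ℚ V)
        rw [hρval, hcoe, hcoeR, LieSubalgebra.coe_bracket, LieRing.of_associative_ring_bracket,
          LieSubalgebra.coe_bracket, LieRing.of_associative_ring_bracket]
        change _ = (ρ d : Module.End ℚ V) * ρ d' - ρ d' * ρ d
        rw [hρval, hρval] }
  have hφinj : Function.Injective φ := by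
    intro d d' h
    have h' : (ρ d : Module.End ℚ V) = ρ d' := congrArg (fun r : R => ((r : 𝔏) : Module.End ℚ V)) h
    rw [hρval, hρval] at h'
    exact Subtype.ext (Subtype.ext h')
  haveI : LieAlgebra.IsSolvable R' := hφinj.lieAlgebra_isSolvable
  have hR'bot : R' = ⊥ := LieAlgebra.HasTrivialRadical.eq_bot_of_isSolvable R'
  -- hence `[𝔏, R] = 0`: the radical is central
  refine LieAlgebra.hasCentralRadical_of_radical_le ℚ 𝔏 fun r hr => ?_
  rw [LieAlgebra.center, LieModule.mem_maxTrivSubmodule]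
  intro x
  have hxr𝔡 : ((⁅x, r⁆ : 𝔏) : Module.End ℚ V) ∈
      Submodule.span ℚ {B | ∃ X ∈ H.hodgeLie, ∃ Y ∈ H.hodgeLie, X * Y - Y * X = B} := by
    rw [LieSubalgebra.coe_bracket, LieRing.of_associative_ring_bracket]
    exact hbr𝔏 _ x.2 _ r.2
  have hmemR' : (⟨((⁅x, r⁆ : 𝔏) : Module.End ℚ V), (hmemd _).2 hxr𝔡⟩ : 𝔏d) ∈ R' :=
    (hR'mem _).2 ⟨⁅x, r⁆, R.lie_mem hr, rfl⟩
  rw [hR'bot, LieSubmodule.mem_bot] at hmemR'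
  have h0 : ((⁅x, r⁆ : 𝔏) : Module.End ℚ V) = 0 := congrArg Subtype.val hmemR'
  exact Subtype.ext h0

/-- `[𝔥, 𝔥] ⊆ 𝔥 ⊆ 𝔪𝔱`. [cite: Deligne1982HodgeCycles, I §3 Prop. 3.4] -/
theorem hodgeLie_derived_le_mumfordTateLieAlgebra (H : HodgeStructure V n) :
    Submodule.span ℚ {B | ∃ X ∈ H.hodgeLie, ∃ Y ∈ H.hodgeLie, X * Y - Y * X = B} ≤ H.mumfordTateLieAlgebra :=
  (Literature.Algebra.Lie.TraceSeparating.derived_le H.hodgeLie fun _ hX _ hY => H.commutator_mem_hodgeLie hX hY).trans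
    (hodgeLie_le_mumfordTateLieAlgebra H)

/-- **`[𝔪𝔱, 𝔪𝔱] ⊆ [𝔥, 𝔥]`**: with `𝔪𝔱 = 𝔥 ⊔ ℚ·id` (`mumfordTateLieAlgebra_eq_hodgeLie_sup`, weight `≠ 0`), the commutator of
`A + a·id` and `B + b·id` is `AB - BA`. [cite: Deligne1982HodgeCycles, I §3 Prop. 3.6] [cite: MoonenZarhin1999LowDim, §2] -/
theorem commutator_mem_hodgeLie_derived_of_mem_mumfordTateLieAlgebra (H : HodgeStructure V n) (ψ : H.Polarization)
    (hn : n ≠ 0) {X Y : Module.End ℚ V} (hX : X ∈ H.mumfordTateLieAlgebra) (hY : Y ∈ H.mumfordTateLieAlgebra) :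
    X * Y - Y * X ∈ Submodule.span ℚ {B | ∃ X ∈ H.hodgeLie, ∃ Y ∈ H.hodgeLie, X * Y - Y * X = B} := by
  rw [mumfordTateLieAlgebra_eq_hodgeLie_sup H ψ hn] at hX hY
  obtain ⟨A, hA, a', ha', rfl⟩ := Submodule.mem_sup.1 hX
  obtain ⟨B, hB, b', hb', rfl⟩ := Submodule.mem_sup.1 hY
  obtain ⟨a, rfl⟩ := Submodule.mem_span_singleton.1 ha'
  obtain ⟨b, rfl⟩ := Submodule.mem_span_singleton.1 hb'
  have e : (A + a • LinearMap.id) * (B + b • LinearMap.id) - (B + b • LinearMap.id) * (A + a • LinearMap.id) =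
      A * B - B * A := by
    rw [add_mul, mul_add, mul_add, add_mul, mul_add, mul_add]
    simp only [Module.End.mul_eq_comp, LinearMap.comp_smul, LinearMap.smul_comp, LinearMap.comp_id, LinearMap.id_comp,
      smul_smul, mul_comm b a]
    abel
  rw [e]
  exact Literature.Algebra.Lie.TraceSeparating.commutator_mem_derived H.hodgeLie hA hB

/-- **DELIGNE I 3.6 (Lie form): the Mumford–Tate Lie algebra of an effective polarizable weight-one Hodge structure is
reductive — its radical is its centre** (`LieAlgebra.HasCentralRadical ℚ 𝔏` for every Lie subalgebra `𝔏 ≤ 𝔤𝔩(V)` with carrier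
`𝔪𝔱 = mumfordTateLieAlgebra H`). [cite: Deligne1982HodgeCycles, I §3 Prop. 3.6] -/
theorem hasCentralRadical_of_eq_mumfordTateLieAlgebra (H : HodgeStructure V n) (hn : n = 1) (heff : H.IsEffective)
    (ψ : H.Polarization) :
    letI : LieRing (Module.End ℚ V) := LieRing.ofAssociativeRing
    ∀ (𝔏 : LieSubalgebra ℚ (Module.End ℚ V)), 𝔏.toSubmodule = H.mumfordTateLieAlgebra →
      LieAlgebra.HasCentralRadical ℚ 𝔏 := by
  letI : LieRing (Module.End ℚ V) := LieRing.ofAssociativeRing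
  intro 𝔏 h𝔏
  have hn0 : n ≠ 0 := by rw [hn]; exact one_ne_zero
  have hmem : ∀ X : Module.End ℚ V, X ∈ 𝔏 ↔ X ∈ H.mumfordTateLieAlgebra := fun X => by
    rw [← LieSubalgebra.mem_toSubmodule, h𝔏]
  refine hasCentralRadical_of_derived_le H hn heff ψ 𝔏 (h𝔏 ▸ hodgeLie_derived_le_mumfordTateLieAlgebra H) ?_
  intro X hX Y hY
  exact commutator_mem_hodgeLie_derived_of_mem_mumfordTateLieAlgebra H ψ hn0 ((hmem X).1 hX) ((hmem Y).1 hY)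

/-- **`[𝔪𝔱, 𝔪𝔱] = [𝔥, 𝔥]`** (as `ℚ`-spans of commutators; weight `≠ 0`, polarized): the derived — semisimple — part of the
Mumford–Tate Lie algebra is that of the Hodge Lie algebra. [cite: Deligne1982HodgeCycles, I §3 Prop. 3.6]
[cite: MoonenZarhin1999LowDim, §2] -/
theorem mumfordTateLieAlgebra_derived_eq (H : HodgeStructure V n) (ψ : H.Polarization) (hn : n ≠ 0) :
    Submodule.span ℚ {B | ∃ X ∈ H.mumfordTateLieAlgebra, ∃ Y ∈ H.mumfordTateLieAlgebra, X * Y - Y * X = B} =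
      Submodule.span ℚ {B | ∃ X ∈ H.hodgeLie, ∃ Y ∈ H.hodgeLie, X * Y - Y * X = B} := by
  refine le_antisymm ?_ ?_
  · rw [Submodule.span_le]
    rintro _ ⟨X, hX, Y, hY, rfl⟩
    exact commutator_mem_hodgeLie_derived_of_mem_mumfordTateLieAlgebra H ψ hn hX hY
  · rw [Submodule.span_le]
    rintro _ ⟨X, hX, Y, hY, rfl⟩
    exact Submodule.subset_span
      ⟨X, hodgeLie_le_mumfordTateLieAlgebra H hX, Y, hodgeLie_le_mumfordTateLieAlgebra H hY, rfl⟩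

end HodgeStructure

end Literature.AlgebraicGeometry.Motives

end
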